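import Mathlib
import HarnessLib
import Summits.ValiantsHypothesis.ValiantsHypothesis.Theses.PermanentalCones
import Summits.ValiantsHypothesis.ValiantsHypothesis.Theorems.PermanentalConesHyperbolicVPShadowStubLinearRealSpectrumNormalForm
import Summits.ValiantsHypothesis.ValiantsHypothesis.Theorems.PermanentalConesHyperbolicVPShadowBridges
import Literature.Computability.AlgebraicComplexity.DeterminantalComplexityProofs
import Literature.AlgebraicGeometry.HyperbolicPolynomials.SpectrahedralShadow

/-!
# ValiantsHypothesis / PermanentalCones — `HyperbolicVPShadow`, line `birth`: the crux, crux #3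
# and the load-bearing stub each contain the Netzer–Sanyal conjecture

Crux `HyperbolicVPShadow` (item `stmt-ValiantsHypothesis-8655`, HT family form), crux #3
`HyperbolicDetShadow` (item `stmt-ValiantsHypothesis-8653`, pencil form) and stub B
`stub_realSpectrumShadow` of line `birth` (real-spectrum normal form) each imply

  (NS) every closed hyperbolicity cone of a real homogeneous form hyperbolic w.r.t. `e` is a
       spectrahedral shadow

— the statement Netzer–Sanyal conjecture for ALL hyperbolicity cones (Math. Program. 153 (2015),
p. 6: "we conjecture that all hyperbolicity cones are spectrahedral shadows"; proved by them for
smooth cones, Thm 1.1 = tree fact `NetzerSanyal2014_thm11`, and by Scheiderer 2025 for Nash-smooth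
cones; OPEN in general). In the tree's vocabulary (NS) reads
`∀ k f e d, f.IsHomogeneous d → IsHyperbolic f e → IsSpectrahedralShadow (hyperbolicityCone f e)`.

* `permanentalCones_netzerSanyal_of_hyperbolicVPShadow` : HT ⇒ (NS), through CONSTANT families
  (`v n = k`, `f n = f`, `e n = e`), which are `VP_ℂ` families with all bounds constant; the size
  bound of HT is not used.
* `permanentalCones_netzerSanyal_of_hyperbolicDetShadow` : crux #3 ⇒ (NS), through Valiant's
  universality of the determinant over `ℝ` (`exists_hasDetRepr_holds`: every real polynomial is
  the determinant of a real affine pencil).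
* `permanentalCones_netzerSanyal_of_realSpectrumShadow` : stub B ⇒ (NS), through the landed
  stub A (`stub_linearRealSpectrumNormalForm`) and bridge
  (`permanentalCones_realSpectrumShadow_iff_hyperbolicDetShadow`).

So a proof of any of the three proves (NS); this is the precise sense in which the line `birth`
(and the route's HT branch) is "open-problem-complete". No claim is made in the other direction.
-/

-- `<Problem> = <Summit>` for this single-conjunct summit (lakefile sets the same option tree-wide).
set_option linter.dupNamespace false

namespace Summit.ValiantsHypothesis.ValiantsHypothesis.Theorems

open MvPolynomial Literature.Computability.AlgebraicComplexity
open Literature.AlgebraicGeometry.HyperbolicPolynomials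
open Summit.ValiantsHypothesis.ValiantsHypothesis.Theses.PermanentalCones

/-- A constant family of complex polynomials is a `VP` family (all three bounds are constant).
[folklore] -/
theorem permanentalCones_isVPFamily_const {k : ℕ} (g : MvPolynomial (Fin k) ℂ) :
    IsVPFamily (σ := fun _ => Fin k) fun _ => g :=
  ⟨⟨by simpa using IsPBounded.const k, IsPBounded.const g.totalDegree⟩,
    IsPBounded.const (complexity g)⟩

/-- **HT ⇒ (NS).** The crux `HyperbolicVPShadow` (item `stmt-ValiantsHypothesis-8655`) implies
that every closed hyperbolicity cone of a real homogeneous hyperbolic form is a spectrahedral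
shadow (the Netzer–Sanyal conjecture, Math. Program. 153 (2015) p. 6, open in general): apply HT
to the constant family. [folklore] -/
theorem permanentalCones_netzerSanyal_of_hyperbolicVPShadow :
    Summit.ValiantsHypothesis.ValiantsHypothesis.Theses.PermanentalCones.HyperbolicVPShadow →
      ∀ (k : ℕ) (f : MvPolynomial (Fin k) ℝ) (e : Fin k → ℝ) (d : ℕ), f.IsHomogeneous d →
        Literature.AlgebraicGeometry.HyperbolicPolynomials.IsHyperbolic f e →
        Literature.AlgebraicGeometry.HyperbolicPolynomials.IsSpectrahedralShadow
          (Literature.AlgebraicGeometry.HyperbolicPolynomials.hyperbolicityCone f e) := by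
  intro h k f e d hf he
  obtain ⟨c, hc⟩ := h (fun _ => k) (fun _ => f) (fun _ => e)
    (permanentalCones_isVPFamily_const _) (fun _ => ⟨d, hf⟩) (fun _ => he)
  obtain ⟨m, -, p, A, B, hrep⟩ := hc 0
  exact ⟨m, p, A, B, hrep⟩

/-- **Crux #3 ⇒ (NS).** `HyperbolicDetShadow` (item `stmt-ValiantsHypothesis-8653`) implies the
Netzer–Sanyal conjecture for all real homogeneous hyperbolic forms, since every real polynomial is
the determinant of a real affine pencil (Valiant's universality, `exists_hasDetRepr_holds`).
[folklore] -/
theorem permanentalCones_netzerSanyal_of_hyperbolicDetShadow :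
    Summit.ValiantsHypothesis.ValiantsHypothesis.Theses.PermanentalCones.HyperbolicDetShadow →
      ∀ (k : ℕ) (f : MvPolynomial (Fin k) ℝ) (e : Fin k → ℝ) (d : ℕ), f.IsHomogeneous d →
        Literature.AlgebraicGeometry.HyperbolicPolynomials.IsHyperbolic f e →
        Literature.AlgebraicGeometry.HyperbolicPolynomials.IsSpectrahedralShadow
          (Literature.AlgebraicGeometry.HyperbolicPolynomials.hyperbolicityCone f e) := by
  rintro ⟨c, hc⟩ k f e d hf he
  obtain ⟨N, M, hM⟩ := exists_hasDetRepr_holds (k := ℝ) f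
  obtain ⟨m, -, p, A, B, hrep⟩ := hc k N f M e hM ⟨d, hf⟩ he
  exact ⟨m, p, A, B, hrep⟩

/-- **Stub B ⇒ (NS).** The load-bearing stub `stub_realSpectrumShadow` of line `birth` implies the
Netzer–Sanyal conjecture for all real homogeneous hyperbolic forms: with the landed stub A
(`stub_linearRealSpectrumNormalForm`) it gives `HyperbolicDetShadow`
(`permanentalCones_realSpectrumShadow_iff_hyperbolicDetShadow`). [folklore] -/
theorem permanentalCones_netzerSanyal_of_realSpectrumShadow :
    (∃ c : ℕ, ∀ (n N : ℕ) (P : (Fin n → ℝ) →ₗ[ℝ] Matrix (Fin N) (Fin N) ℝ),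
      (∀ (x : Fin n → ℝ) (z : ℂ),
        ((P x).map (algebraMap ℝ ℂ) - z • (1 : Matrix (Fin N) (Fin N) ℂ)).det = 0 → z.im = 0) →
      ∃ m ≤ 2 ^ ((Nat.log 2 N + c) ^ c),
        ∃ (p : ℕ) (A : (Fin n → ℝ) × (Fin p → ℝ) →ₗ[ℝ] Matrix (Fin m) (Fin m) ℝ)
          (B : Matrix (Fin m) (Fin m) ℝ), ∀ x : Fin n → ℝ,
          (∀ τ : ℝ, 0 < τ → (P x + τ • (1 : Matrix (Fin N) (Fin N) ℝ)).det ≠ 0) ↔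
            ∃ y : Fin p → ℝ, (A (x, y) + B).PosSemidef) →
      ∀ (k : ℕ) (f : MvPolynomial (Fin k) ℝ) (e : Fin k → ℝ) (d : ℕ), f.IsHomogeneous d →
        Literature.AlgebraicGeometry.HyperbolicPolynomials.IsHyperbolic f e →
        Literature.AlgebraicGeometry.HyperbolicPolynomials.IsSpectrahedralShadow
          (Literature.AlgebraicGeometry.HyperbolicPolynomials.hyperbolicityCone f e) :=
  fun hB => permanentalCones_netzerSanyal_of_hyperbolicDetShadow
    ((permanentalCones_realSpectrumShadow_iff_hyperbolicDetShadow
      stub_linearRealSpectrumNormalForm).1 hB)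

end Summit.ValiantsHypothesis.ValiantsHypothesis.Theorems
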